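import Mathlib
import Summits.NavierStokesRegularity.NavierStokesRegularity.Theorems.TaoLadderRungTwoFlatHopTubeWithStatics
import HarnessLib

/-!
# The INITIAL GAUGE DISTANCE of a kicked R54 tube state to the reference start, over ALL shells (the input `hB`/`hBof` of
  `R54.hop_apriori_graded` / `HopTube.tubeStepNearBehindR54_of_schedule'`) (helper for the K_A♭ parent item
  stmt-NavierStokesRegularity-22987 `FlatGapCertificatesV2`, child 2A `GradedAdiabaticWakeA` of route TaoLadderRungTwoFlat;
  cell harvest/h2-tao-ladder, p1 g23; LADDER §50, §54, §58)

For a tube state `z` of the R54 tube at hop `n > N₀`, a kicked start `S₀` (`w_k|S₀ − z| ≤ r`) and a reference start `W₀`, the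
contraction-gauge distance `ω_{ik}|S₀ − W₀|` (`ω = geomGauge g b`) is bounded shell by shell by: the kick `C_κ·r` (`ω ≤ C_κ·w`), on
the window half-line `k ≥ −K` the core radius `δ(n)` plus the reference-start mismatch `E_ref` (`ω|x(z)u⋆ − W₀|`), and behind the
window the (B1) extraction `√(2W_b n)·(b^K)⁻¹` (slow exponent `θ′ ≤ 2·log b`: the gauge decay `b^{−|k|}` beats the (B1) allowance
`e^{θ′(−K−k)/2}`) plus the reference's own gauge size `E_Wb` behind.

* `exp_slow_mul_geomGauge_le` — `ω_k·e^{θ′(−K−k)/2} ≤ (b^K)⁻¹` for `k < −K`, `θ′ ≤ 2 log b`;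
* `initial_gaugeDist_of_inTubeR54` — the bound, `B := C_κ r + δ(n) + E_ref + √(2W_b n)(b^K)⁻¹ + E_Wb`.

HONEST FRAMING: bookkeeping over the cell's typed induction frame (MODEL lattice, graded mirror table on `S♭`, `m = 2`); the
reference-start data are HYPOTHESES; nothing certified; no item closed; nothing about the Navier–Stokes equations.
-/

noncomputable section

-- the sub-problem namespace repeats the summit name by design (D-0017)
set_option linter.dupNamespace false

namespace Summit.NavierStokesRegularity.NavierStokesRegularity.Theorems.HopTube

open Set Finset Literature.Analysis.FluidPDE Literature.Analysis.FluidPDE.TaoCascade MirrorPulse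

/-- **The gauge decay beats the slow (B1) allowance behind the window**: for `k < −K`, `1 ≤ b`, `θ′ ≤ 2·log b`:
`geomGauge g b i k · e^{θ′(−K−k)/2} ≤ (b^K)⁻¹`. [cite: Tao2016AveragedNS, §6.3 (weighted norms, statement shape); cell LADDER §54 (R54-1 slow exponent), §58] -/
theorem exp_slow_mul_geomGauge_le {g b θ' : ℝ} (hb : 1 ≤ b) (hθ : θ' ≤ 2 * Real.log b) (K : ℕ) (i : Fin 2) {k : ℤ}
    (hk : k < -(K : ℤ)) :
    geomGauge g b i k * Real.exp (θ' * (-(K : ℝ) - k) / 2) ≤ (b ^ K)⁻¹ := by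
  have hb0 : 0 < b := by linarith
  obtain ⟨d, hd⟩ : ∃ d : ℕ, (d : ℤ) = -k := ⟨(-k).toNat, Int.toNat_of_nonneg (by omega)⟩
  have hdK : K + 1 ≤ d := by
    have : ((K : ℤ) + 1) ≤ (d : ℤ) := by omega
    exact_mod_cast this
  have hω : geomGauge g b i k = (b ^ d)⁻¹ := by
    unfold geomGauge
    have h1 : k.toNat = 0 := Int.toNat_eq_zero.mpr (by omega)
    have h2 : (-k).toNat = d := by
      have := congrArg Int.toNat hd.symm
      simpa using this
    rw [h1, h2, pow_zero, one_mul]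
  -- `e^{θ′(−K−k)/2} ≤ b^{d−K}`
  have hexp : Real.exp (θ' * (-(K : ℝ) - k) / 2) ≤ b ^ (d - K) := by
    have hdk : (-(K : ℝ) - k) = ((d - K : ℕ) : ℝ) := by
      rw [Nat.cast_sub (by omega)]
      have : (k : ℝ) = -(d : ℝ) := by
        have := congrArg (fun z : ℤ => (z : ℝ)) hd
        push_cast at this; linarith
      rw [this]; ring
    rw [hdk]
    have hlog : θ' * ((d - K : ℕ) : ℝ) / 2 ≤ Real.log b * ((d - K : ℕ) : ℝ) := by
      have h0 : (0 : ℝ) ≤ ((d - K : ℕ) : ℝ) := Nat.cast_nonneg _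
      nlinarith
    calc Real.exp (θ' * ((d - K : ℕ) : ℝ) / 2) ≤ Real.exp (Real.log b * ((d - K : ℕ) : ℝ)) :=
          Real.exp_le_exp.mpr hlog
      _ = b ^ (d - K) := by rw [← Real.rpow_natCast, Real.rpow_def_of_pos hb0]
  have hbd : 0 < b ^ d := pow_pos hb0 d
  rw [hω]
  calc (b ^ d)⁻¹ * Real.exp (θ' * (-(K : ℝ) - k) / 2) ≤ (b ^ d)⁻¹ * b ^ (d - K) :=
        mul_le_mul_of_nonneg_left hexp (inv_nonneg.mpr hbd.le)
    _ = (b ^ K)⁻¹ := by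
        have e : b ^ d = b ^ (d - K) * b ^ K := by rw [← pow_add, Nat.sub_add_cancel (by omega)]
        rw [e, mul_inv, mul_assoc, mul_comm ((b ^ K)⁻¹), ← mul_assoc,
          inv_mul_cancel₀ (pow_ne_zero _ hb0.ne'), one_mul]

/-- **INITIAL GAUGE DISTANCE OF A KICKED R54 TUBE STATE TO THE REFERENCE START.** See the module docstring.
[cite: Tao2016AveragedNS, §6.3–6.4 (statement shape); route TaoLadderRungTwoFlat, input `hB` of `R54.hop_apriori_graded` (cell LADDER §50, §54, §58)] -/
theorem initial_gaugeDist_of_inTubeR54 (P : TubeSchedule) {θ' : ℝ} {Wb : ℕ → ℝ} {i₀ : Fin 2} {X₀ : Fin 2 → ℝ}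
    {w : ℤ → ℝ} {r : ℝ} {ζ : ℕ → Fin 2 → ℤ → ℝ} {ustar : Fin 2 → ℤ → ℝ} {n : ℕ} {z S₀ W₀ : Fin 2 → ℤ → ℝ}
    {Cκ Eref EWb : ℝ}
    (hg : 0 < P.g) (hb : 1 ≤ P.b) (hθ : θ' ≤ 2 * Real.log P.b) (hn : P.N₀ < n) (hWbn : 0 ≤ Wb n)
    (hz : InTubeWith P (behindR54 P θ' Wb) i₀ X₀ w r ζ ustar n z)
    (hkick : ∀ i k, w k * |S₀ i k - z i k| ≤ r)
    (hCκ : 0 ≤ Cκ) (hωw : ∀ (i : Fin 2) (k : ℤ), geomGauge P.g P.b i k ≤ Cκ * w k)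
    (hEref : ∀ (i : Fin 2) (k : ℤ), -(P.K : ℤ) ≤ k →
      geomGauge P.g P.b i k * |anchorScale P i₀ z * ustar i k - W₀ i k| ≤ Eref)
    (hEWb : ∀ (i : Fin 2) (k : ℤ), k < -(P.K : ℤ) → geomGauge P.g P.b i k * |W₀ i k| ≤ EWb)
    (hEref0 : 0 ≤ Eref) (hEWb0 : 0 ≤ EWb) (i : Fin 2) (k : ℤ) :
    geomGauge P.g P.b i k * |S₀ i k - W₀ i k|
      ≤ Cκ * r + P.δ n + Eref + Real.sqrt (2 * Wb n) * (P.b ^ P.K)⁻¹ + EWb := by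
  have h0 : n ≠ 0 := by omega
  have h1 : ¬ n ≤ P.N₀ := by omega
  simp only [InTubeWith, h0, if_false, h1] at hz
  obtain ⟨-, hcore, -, hbeh, -⟩ := hz
  have hω0 : 0 ≤ geomGauge P.g P.b i k := (geomGauge_pos hg (by linarith) i k).le
  have hδ0 : 0 ≤ P.δ n := le_trans (mul_nonneg (geomGauge_pos hg (by linarith) 0 0).le (abs_nonneg _)) (hcore 0 0 (by omega))
  have hsq0 : 0 ≤ Real.sqrt (2 * Wb n) * (P.b ^ P.K)⁻¹ := by
    have : 0 < P.b ^ P.K := pow_pos (by linarith) _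
    positivity
  -- the kick in the gauge
  have hkickω : geomGauge P.g P.b i k * |S₀ i k - z i k| ≤ Cκ * r := by
    have hk1 := hkick i k
    calc geomGauge P.g P.b i k * |S₀ i k - z i k| ≤ Cκ * w k * |S₀ i k - z i k| :=
          mul_le_mul_of_nonneg_right (hωw i k) (abs_nonneg _)
      _ = Cκ * (w k * |S₀ i k - z i k|) := by ring
      _ ≤ Cκ * r := mul_le_mul_of_nonneg_left hk1 hCκ
  -- split `S₀ − W₀ = (S₀ − z) + (z − W₀)`
  have hsplit : |S₀ i k - W₀ i k| ≤ |S₀ i k - z i k| + |z i k - W₀ i k| := by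
    have e : S₀ i k - W₀ i k = (S₀ i k - z i k) + (z i k - W₀ i k) := by ring
    rw [e]; exact abs_add_le _ _
  have hmain : geomGauge P.g P.b i k * |z i k - W₀ i k|
      ≤ P.δ n + Eref + Real.sqrt (2 * Wb n) * (P.b ^ P.K)⁻¹ + EWb := by
    by_cases hk : -(P.K : ℤ) ≤ k
    · -- on the window half-line: core radius + reference-start mismatch
      have hc := hcore i k hk
      have he := hEref i k hk
      have e : z i k - W₀ i k = (z i k - anchorScale P i₀ z * ustar i k) + (anchorScale P i₀ z * ustar i k - W₀ i k) := by
        ring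
      calc geomGauge P.g P.b i k * |z i k - W₀ i k|
          ≤ geomGauge P.g P.b i k * (|z i k - anchorScale P i₀ z * ustar i k|
              + |anchorScale P i₀ z * ustar i k - W₀ i k|) := by
            rw [e]; exact mul_le_mul_of_nonneg_left (abs_add_le _ _) hω0
        _ ≤ P.δ n + Eref := by rw [mul_add]; exact add_le_add hc he
        _ ≤ _ := by linarith
    · -- behind the window: (B1) extraction with the slow exponent, and the reference's own size
      rw [not_le] at hk
      have hz1 := R54.abs_le_of_behindEnergyClause hWbn hbeh.1 i hk
      have hW1 := hEWb i k hk
      have hzω : geomGauge P.g P.b i k * |z i k| ≤ Real.sqrt (2 * Wb n) * (P.b ^ P.K)⁻¹ := by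
        calc geomGauge P.g P.b i k * |z i k|
            ≤ geomGauge P.g P.b i k * (Real.sqrt (2 * Wb n) * Real.exp (θ' * (-(P.K : ℝ) - k) / 2)) :=
              mul_le_mul_of_nonneg_left hz1 hω0
          _ = Real.sqrt (2 * Wb n) * (geomGauge P.g P.b i k * Real.exp (θ' * (-(P.K : ℝ) - k) / 2)) := by ring
          _ ≤ Real.sqrt (2 * Wb n) * (P.b ^ P.K)⁻¹ :=
              mul_le_mul_of_nonneg_left (exp_slow_mul_geomGauge_le hb hθ P.K i hk) (Real.sqrt_nonneg _)
      calc geomGauge P.g P.b i k * |z i k - W₀ i k|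
          ≤ geomGauge P.g P.b i k * (|z i k| + |W₀ i k|) := mul_le_mul_of_nonneg_left (abs_sub _ _) hω0
        _ ≤ Real.sqrt (2 * Wb n) * (P.b ^ P.K)⁻¹ + EWb := by rw [mul_add]; exact add_le_add hzω hW1
        _ ≤ _ := by linarith
  calc geomGauge P.g P.b i k * |S₀ i k - W₀ i k|
      ≤ geomGauge P.g P.b i k * (|S₀ i k - z i k| + |z i k - W₀ i k|) := mul_le_mul_of_nonneg_left hsplit hω0
    _ = geomGauge P.g P.b i k * |S₀ i k - z i k| + geomGauge P.g P.b i k * |z i k - W₀ i k| := mul_add _ _ _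
    _ ≤ Cκ * r + (P.δ n + Eref + Real.sqrt (2 * Wb n) * (P.b ^ P.K)⁻¹ + EWb) := add_le_add hkickω hmain
    _ = _ := by ring

end Summit.NavierStokesRegularity.NavierStokesRegularity.Theorems.HopTube

end
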